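import Summits.BirchSwinnertonDyer.BirchSwinnertonDyer.Theses.GoldfeldAllTwistsTwoConverse
import Summits.BirchSwinnertonDyer.BirchSwinnertonDyer.Theorems.GoldfeldGoodTwistsAllTwistsCells
import Literature.NumberTheory.EllipticCurves.BSDSelmerPConverseYanZhuProofs
import Literature.NumberTheory.EllipticCurves.PAdicBSDKatoFiniteProofs
import HarnessLib

set_option linter.dupNamespace false
set_option autoImplicit false

/-!
# Crux K12₂″ along ROUTE B AT `p = 2`: reduction to a `K`-level `2`-converse over an auxiliary
# Heegner field in which `2` SPLITS

Cell `bsd-goldfeld`, prover seat `s1p-c201`, item `stmt-BirchSwinnertonDyer-20044` (crux K12₂″ =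
`Theses.GoldfeldAllTwistsTwoConverse.RankOneTwoConverseCMSevenAdditiveTwo`: for a globally minimal
elliptic `W/ℚ` with `j(W) = −3375` and NOT good reduction at `2`, `corank_{ℤ₂} Sel_{2^∞}(W/ℚ) = 1 ⟹
ord_{s=1} L(W, s) = 1`). OPEN; nothing asserted. This is STEP A of the cell's TARGET (§2, s1p-c201):
the architecture "route B" by which the tree decomposes every printed rank-one `p`-converse over `ℚ`
(Yan–Zhu Thm. 4.15 / BSTW Thm. 1.10 / Burungale–Tian Thm. 1.2 — `BSDSelmerPConverseYanZhuProofs`,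
`BSDSelmerCMPConverseHeegnerFieldProofs` Part 3, there for `p ≥ 5` good ordinary with BCGS Cor. 1 as the
`K`-level leaf `hBCGS`) run VERBATIM AT `p = 2` for the `ℚ(√−7)`-curves with additive reduction at `2`:

(a) `2`-parity (Dokchitser–Dokchitser Thm. 1.4 with Cor. 4.20, EVERY prime incl. `p = 2`; tree fact
`p_parity`): corank `1` ⟹ `w(W) = −1`; (b) an auxiliary imaginary quadratic `K` with every `ℓ ∣ N_W` split
(so `2` SPLIT, `d_K ≡ 1 (mod 8)`) and `L(W^{(d_K)}, 1) ≠ 0` (Modularity + Hoffstein–Luo 1997, tree facts,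
through `exists_heegnerField_split_twist_ne_zero_discr_emod_eight_of_hoffsteinLuo`, `p`-uniform); (c)
finiteness of `Sel_{2^∞}(W^{(d_K)}/ℚ)` from `L ≠ 0` (Gross–Zagier–Kolyvagin over `ℚ`, tree fact
`rank_eq_analyticRank_of_analyticRank_le_one`, via `kato_finite_of_L_one_ne_zero_of_rank_eq_analyticRank`);
(d) `corank Sel_{2^∞}(W/K) = 1 + 0` (tree THEOREM `selmerCorank_baseChange_quadratic_holds`, any `p`);
(e) the `K`-LEVEL LEAF `KLevelTwoConverseCMSevenSplit` (OPEN, `@[conjecture]`, nothing asserted):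
`corank_{ℤ₂} Sel_{2^∞}(W/K) = 1 ⟹ ord_{s=1} L(W/K, s) = 1` for such `(W, K)` — the `p = 2`, additive,
residually-reducible (`W(ℚ)[2] = ℤ/2`) shape of Burungale–Castella–Grossi–Skinner Cor. 1, outside every
printed hypothesis list (`p` odd; good ordinary); (f) Artin formalism `ord L(W/K) = ord L(W) + 0`.

Companion of `GoldfeldK12AdditiveTwoBaseChange.lean` (the OTHER `K`-level shape: one good-ordinary curve
`X₀(49)` over `K` with `2` RAMIFIED). Here `2` SPLITS in `K` (the anticyclotomic `ℤ₂`-tower and a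
BDP-type `2`-adic `L`-function over `K` make sense) but the curve `W` is additive, potentially good
ordinary, at `2`. Which shape a future `2`-adic argument prefers is open; both are equivalent to K12₂″
modulo print (this file proves the implication leaf ⟹ crux; the converse needs the nonvanishing twist
and is immediate from Artin formalism, `kLevelTwoConverseCMSevenSplit_of_additiveCell`).

No `sorry`, no new axiom, no instance, no notation. Binders are existing cite-tagged tree facts:
`p_parity`, `ModularForms.exists_isNewformOf`, `HoffsteinLuo1997_exists_twist_L_one_ne_zero`,
`rank_eq_analyticRank_of_analyticRank_le_one`.

References: T. and V. Dokchitser, Ann. of Math. 172 (2010) Thm. 1.4, Cor. 4.20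
[DokchitserDokchitserAnnals2010]; J. Hoffstein, W. Luo, Math. Res. Lett. 4 (1997) [HoffsteinLuo1997];
A. Burungale, F. Castella, G. Grossi, C. Skinner, arXiv:2312.09301 Thm. 1 / Cor. 1 [BurungaleEtAl2026];
X. Yan, X. Zhu, arXiv:2412.20078 Thm. 4.15 (proof, §4.6) [YanZhu2024MainConjNonCM]; A. Burungale,
F. Castella, C. Skinner, Y. Tian, Ann. Math. Qué. 46 (2022) Rem. D [BurungaleCastellaSkinnerTian2022];
B. Gross, D. Zagier, Invent. Math. 84 (1986) I.§7 [GrossZagier1986].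
-/

noncomputable section

open scoped Classical

open WeierstrassCurve Literature.NumberTheory.EllipticCurves

namespace Summit.BirchSwinnertonDyer.BirchSwinnertonDyer.Theorems.GoldfeldGoodTwists

/-! ## §1 The `K`-level leaf at `p = 2` over a Heegner field with `2` split -/

/-- **LEAF `KLevelTwoConverseCMSevenSplit` (OPEN; nothing asserted).** For every globally minimal elliptic
`W/ℚ` with `j(W) = −3375` (CM by `ℤ[(1+√−7)/2]`) and NOT good (hence additive, potentially good ordinary)
reduction at `2`, and every imaginary quadratic field `K` with: every prime `ℓ ∣ N_W` split in `K`
(Heegner hypothesis for the conductor; in particular `2` splits), `2` split, `d_K ≡ 1 (mod 8)`, and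
`L(W^{(d_K)}, 1) ≠ 0` — the rank-one `2^∞`-Selmer converse over `K`:
`corank_{ℤ₂} Sel_{2^∞}(W/K) = 1 ⟹ ord_{s=1} L(W/K, s) = 1` (`analyticRankEK`). The `p = 2` analogue, for
these residually reducible CM curves at an additive prime, of Burungale–Castella–Grossi–Skinner Cor. 1
(printed for `p` odd, good ordinary, (irr), (tor), (disc)); the slot `hBCGS` of the tree's route-B files
read at `p = 2`. Implies crux K12₂″ (`rankOneTwoConverseCMSevenAdditiveTwo_of_kLevelTwoConverseSplit`).
[cite: BurungaleEtAl2026, Thm. 1 and Cor. 1 (arXiv:2312.09301, §0.1, pp. 3–4) — hypotheses p odd, good ordinary]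
[cite: BurungaleCastellaSkinnerTian2022, Rem. D (p. 327)] -/
@[conjecture] def KLevelTwoConverseCMSevenSplit : Prop :=
  ∀ (W : WeierstrassCurve ℚ) [W.IsElliptic] [W.IsGloballyMinimal], W.j = -3375 →
    ¬ W.HasGoodReductionAtPrime 2 →
    ∀ (K : Type) [Field K] [NumberField K], IsImaginaryQuadratic K →
      SatisfiesHeegnerHypothesis (W.conductorNorm ℤ) K → SatisfiesHeegnerHypothesis 2 K →
      NumberField.discr K % 8 = 1 →
      (W.quadraticTwist (NumberField.discr K : ℚ)).entireLFunction 1 ≠ 0 →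
      (W.baseChange K).selmerCorank 2 = 1 → analyticRankEK W K = 1

/-! ## §2 Route B at `p = 2`: the leaf implies the crux -/

/-- **Route B at `p = 2`, from the sign onwards.** For a globally minimal `W` with `j = −3375`, not good
at `2`, `w(W) = −1` and `corank Sel_{2^∞}(W/ℚ) = 1`: (b) the Hoffstein–Luo field `K` (`hmod`, `hHL`:
every `ℓ ∣ N_W` split, `2` split, `d_K ≡ 1 (mod 8)`, `L(W^{(d_K)},1) ≠ 0`); (c) `Sel_{2^∞}(W^{(d_K)}/ℚ)`
finite (`hKato` at `p = 2`); (d) corank over `K` is `1 + 0`; (e) the leaf; (f) Artin formalism.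
[cite: YanZhu2024MainConjNonCM, Thm. 4.15 (proof, §4.6)] [cite: HoffsteinLuo1997, Theorem (§1, pp. 435–436)]
[cite: GrossZagier1986, I.§7] -/
theorem analyticRank_eq_one_of_kLevelTwoConverseSplit_of_rootNumber_eq_neg_one
    (hmod : ModularForms.exists_isNewformOf) (hHL : HoffsteinLuo1997_exists_twist_L_one_ne_zero)
    (hKato : ∀ (W : WeierstrassCurve ℚ) [W.IsElliptic], kato_finite_of_L_one_ne_zero W 2)
    (hXL : KLevelTwoConverseCMSevenSplit)
    (W : WeierstrassCurve ℚ) [W.IsElliptic] [W.IsGloballyMinimal] (hj : W.j = -3375)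
    (hbad : ¬ W.HasGoodReductionAtPrime 2) (hw : W.rootNumber = -1) (hcorank : W.selmerCorank 2 = 1) :
    W.analyticRank = 1 := by
  -- (b) the auxiliary imaginary quadratic field, from Hoffstein–Luo, with `d_K ≡ 1 (mod 8)`
  obtain ⟨K, _, _, hK, -, hHN, hHp, hd8, hL1⟩ :=
    exists_heegnerField_split_twist_ne_zero_discr_emod_eight_of_hoffsteinLuo hmod hHL W hw
      Nat.prime_two 0
  -- (c) the `2^∞`-Selmer group of the twist is finite, hence of corank `0`
  have hd : (NumberField.discr K : ℚ) ≠ 0 := by exact_mod_cast NumberField.discr_ne_zero K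
  haveI := W.isElliptic_quadraticTwist hd
  obtain ⟨-, -, hfin⟩ := hKato (W.quadraticTwist (NumberField.discr K : ℚ)) hL1
  haveI := hfin
  have h0 : (W.quadraticTwist (NumberField.discr K : ℚ)).selmerCorank 2 = 0 :=
    (W.quadraticTwist (NumberField.discr K : ℚ)).selmerCorank_eq_zero_of_finite 2
  -- (d) the corank over `K` is `1 + 0 = 1`
  have hK1 : (W.baseChange K).selmerCorank 2 = 1 := by
    rw [selmerCorank_baseChange_quadratic_holds W K hK.1 2, hcorank, h0]
  -- (e) the `K`-level leaf at `p = 2`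
  have hEK : analyticRankEK W K = 1 := hXL W hj hbad K hK hHN hHp hd8 hL1 hK1
  -- (f) factorisation of the analytic rank over `K`
  rw [analyticRankEK_eq_add_of (hasEntireLFunction_rat_of_exists_isNewformOf hmod) W K,
    analyticRank_eq_zero_of_entireLFunction_one_ne_zero _ hL1, add_zero] at hEK
  exact hEK

/-- **Crux K12₂″ along route B at `p = 2`** (type = the route decl, fully qualified): from (a) the
`2`-parity theorem (`hpar`, tree fact `p_parity` at `p = 2`: Dokchitser–Dokchitser Thm. 1.4 with Cor.
4.20), Modularity (`hmod`), Hoffstein–Luo (`hHL`), finiteness of `Sel_{2^∞}` of a twist with `L ≠ 0`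
(`hKato` at `p = 2`) and the `K`-level leaf `KLevelTwoConverseCMSevenSplit` (`hXL`).
[cite: DokchitserDokchitserAnnals2010, Thm. 1.4 and Cor. 4.20] [cite: YanZhu2024MainConjNonCM, Thm. 4.15 (proof, §4.6)]
[cite: BurungaleCastellaSkinnerTian2022, Rem. D (p. 327)] -/
theorem rankOneTwoConverseCMSevenAdditiveTwo_of_kLevelTwoConverseSplit
    (hpar : ∀ (W : WeierstrassCurve ℚ) [W.IsElliptic], p_parity W 2)
    (hmod : ModularForms.exists_isNewformOf) (hHL : HoffsteinLuo1997_exists_twist_L_one_ne_zero)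
    (hKato : ∀ (W : WeierstrassCurve ℚ) [W.IsElliptic], kato_finite_of_L_one_ne_zero W 2)
    (hXL : KLevelTwoConverseCMSevenSplit) :
    Summit.BirchSwinnertonDyer.BirchSwinnertonDyer.Theses.GoldfeldAllTwistsTwoConverse.RankOneTwoConverseCMSevenAdditiveTwo := by
  intro W _ _ hj hbad hcorank
  -- (a) parity: the root number is `-1`
  have hw : W.rootNumber = -1 := by
    have h := hpar W
    unfold p_parity at h
    rw [hcorank, pow_one] at h
    exact h.symm
  exact analyticRank_eq_one_of_kLevelTwoConverseSplit_of_rootNumber_eq_neg_one hmod hHL hKato hXL W hj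
    hbad hw hcorank

/-- **Crux K12₂″ along route B at `p = 2`, with Gross–Zagier–Kolyvagin over `ℚ` in place of Kato**:
leaf (c) from the tree fact `rank_eq_analyticRank_of_analyticRank_le_one` (a conjunct of the route's
`PublishedFactsAllTwists`) through `kato_finite_of_L_one_ne_zero_of_rank_eq_analyticRank`. So along
route B the crux rests on: `2`-parity, Modularity, Hoffstein–Luo, Gross–Zagier–Kolyvagin over `ℚ`, and
the leaf `KLevelTwoConverseCMSevenSplit`. [cite: DokchitserDokchitserAnnals2010, Thm. 1.4 and Cor. 4.20]
[cite: HoffsteinLuo1997, Theorem (§1, pp. 435–436)] [cite: GrossZagier1986, I.§7] -/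
theorem rankOneTwoConverseCMSevenAdditiveTwo_of_kLevelTwoConverseSplit_of_rank_eq_analyticRank
    (hpar : ∀ (W : WeierstrassCurve ℚ) [W.IsElliptic], p_parity W 2)
    (hmod : ModularForms.exists_isNewformOf) (hHL : HoffsteinLuo1997_exists_twist_L_one_ne_zero)
    (hGZK : rank_eq_analyticRank_of_analyticRank_le_one) (hXL : KLevelTwoConverseCMSevenSplit) :
    Summit.BirchSwinnertonDyer.BirchSwinnertonDyer.Theses.GoldfeldAllTwistsTwoConverse.RankOneTwoConverseCMSevenAdditiveTwo :=
  rankOneTwoConverseCMSevenAdditiveTwo_of_kLevelTwoConverseSplit hpar hmod hHL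
    (fun W _ ↦ kato_finite_of_L_one_ne_zero_of_rank_eq_analyticRank W 2 hGZK) hXL

/-! ## §3 The converse: the crux implies the leaf -/

/-- **The leaf from K12₂″** (so the leaf is not stronger than the crux, modulo Modularity and the
finiteness of `Sel_{2^∞}` of a rank-zero twist): given `L(W^{(d_K)}, 1) ≠ 0`, `corank Sel_{2^∞}(W/K) =
corank(W) + 0`, so K12₂″ gives `ord L(W) = 1` and `ord L(W/K) = 1 + 0`.
[cite: GrossZagier1986, I.§7] [cite: BurungaleCastellaSkinnerTian2022, Rem. D (p. 327)] -/
theorem kLevelTwoConverseCMSevenSplit_of_additiveCell (hmod : ModularForms.exists_isNewformOf)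
    (hKato : ∀ (W : WeierstrassCurve ℚ) [W.IsElliptic], kato_finite_of_L_one_ne_zero W 2)
    (hXL : Summit.BirchSwinnertonDyer.BirchSwinnertonDyer.Theses.GoldfeldAllTwistsTwoConverse.RankOneTwoConverseCMSevenAdditiveTwo) :
    KLevelTwoConverseCMSevenSplit := by
  intro W _ _ hj hbad K _ _ hK _ _ _ hL1 hK1
  have hd : (NumberField.discr K : ℚ) ≠ 0 := by exact_mod_cast NumberField.discr_ne_zero K
  haveI := W.isElliptic_quadraticTwist hd
  obtain ⟨-, -, hfin⟩ := hKato (W.quadraticTwist (NumberField.discr K : ℚ)) hL1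
  haveI := hfin
  have h0 : (W.quadraticTwist (NumberField.discr K : ℚ)).selmerCorank 2 = 0 :=
    (W.quadraticTwist (NumberField.discr K : ℚ)).selmerCorank_eq_zero_of_finite 2
  have hcorank : W.selmerCorank 2 = 1 := by
    have h := hK1
    rw [selmerCorank_baseChange_quadratic_holds W K hK.1 2, h0, add_zero] at h
    exact h
  rw [analyticRankEK_eq_add_of (hasEntireLFunction_rat_of_exists_isNewformOf hmod) W K,
    analyticRank_eq_zero_of_entireLFunction_one_ne_zero _ hL1, add_zero]
  exact hXL W hj hbad hcorank

/-- **K12₂″ ⟺ the route-B leaf at `p = 2`**, granted `2`-parity, Modularity, Hoffstein–Luo and the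
finiteness of `Sel_{2^∞}` of rank-zero twists. [cite: DokchitserDokchitserAnnals2010, Thm. 1.4 and Cor. 4.20]
[cite: BurungaleCastellaSkinnerTian2022, Rem. D (p. 327)] -/
theorem rankOneTwoConverseCMSevenAdditiveTwo_iff_kLevelTwoConverseSplit
    (hpar : ∀ (W : WeierstrassCurve ℚ) [W.IsElliptic], p_parity W 2)
    (hmod : ModularForms.exists_isNewformOf) (hHL : HoffsteinLuo1997_exists_twist_L_one_ne_zero)
    (hKato : ∀ (W : WeierstrassCurve ℚ) [W.IsElliptic], kato_finite_of_L_one_ne_zero W 2) :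
    Summit.BirchSwinnertonDyer.BirchSwinnertonDyer.Theses.GoldfeldAllTwistsTwoConverse.RankOneTwoConverseCMSevenAdditiveTwo ↔
      KLevelTwoConverseCMSevenSplit :=
  ⟨kLevelTwoConverseCMSevenSplit_of_additiveCell hmod hKato,
    rankOneTwoConverseCMSevenAdditiveTwo_of_kLevelTwoConverseSplit hpar hmod hHL hKato⟩

end Summit.BirchSwinnertonDyer.BirchSwinnertonDyer.Theorems.GoldfeldGoodTwists

end
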